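import Summits.BirchSwinnertonDyer.BirchSwinnertonDyer.Theorems.ResidualThetaTransportAtTwoOnePairSupplyDefs
import Summits.BirchSwinnertonDyer.BirchSwinnertonDyer.Theorems.ResidualThetaTransportAtTwoResidualSignedLambdaLowerCMAtTwoSupplySlack
import Summits.BirchSwinnertonDyer.BirchSwinnertonDyer.Theorems.ResidualThetaTransportAtTwoResidualSignedLambdaLowerCMAtTwoSupplyPlaceCut
import Summits.BirchSwinnertonDyer.BirchSwinnertonDyer.Theorems.ResidualThetaTransportAtTwoResidualSignedLambdaLowerCMAtTwoSupplyDeepHalf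
import Summits.BirchSwinnertonDyer.BirchSwinnertonDyer.Theorems.ResidualThetaTransportAtTwoResidualSignedLambdaLowerCMAtTwoSupplyReciprocity
import Summits.BirchSwinnertonDyer.BirchSwinnertonDyer.Theorems.ResidualThetaTransportAtTwoResidualSignedLambdaLowerCMAtTwoAtTwoCompat
import Mathlib.RingTheory.Localization.FractionRing
import Mathlib.RingTheory.TensorProduct.Basic
import Mathlib.LinearAlgebra.Dimension.Finrank
import HarnessLib

/-!
# ASSEMBLY clause C8 of the one-pair glue: the N5 datum `(P, pair, locd, Z, Sel₀, e, f, B)` of `stub_onePairSupply` from the clause files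

Route `ResidualThetaTransportAtTwo` (RTT), crux RSL_g `ResidualSignedLambdaLowerCMAtTwo` (stmt-BirchSwinnertonDyer-22608), line «onepair» (v3d),
`Cruxes/ResidualSignedLambdaLowerCMAtTwo/ASSEMBLY-SPEC-g19.md` clause C8; LEAD `prover-bsd-wall-rtt-p2` g19 (`--supports 22608 --as helper`, closes
nothing). THEOREMS ONLY (no definition, no named fact, no instance, no `sorry`). BSD is not proved by any of this; RSL_g is OPEN.

WHAT. `OnePair.onePairSupply_of_packages`: for a pin bundle `π`, its AtTwo package T1 `(π₂, PERF₂, E⁺)` (`AtTwoPackage.exists_atTwoPins_perfect`,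
p706129), its Away package T2 `πₐ` (`OnePair.exists_awayPins`), S2's value character `pair₂` at the pins (VAL + KER clauses of
`OnePair.stub_plusColemanO`, p690960), the split statements EH / S4₂ / S4₀ at `(π, π₂, πₐ)`, the `Sel₀`-orthogonality integrand (w2's C4
`OnePairPins.c₂_add_sum_locAway_eq_zero_of_mem_Sel₀`) and the S₀-side compatibility integrand (w2's C5 `OnePairPins.sum_smul_locAway`) — both taken as
hypotheses in their own currency — and the three counts (w2's C7 `finite_and_count_span_locd_pins`, C6 `supplyZeta_of_pins`, in the supply's literal
currency), THE N5 datum of the registered glue stub holds with the witnesses of §0 (`…OnePairSupplyDefs`):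
`P := ℤ₂⟦X⟧ⁿ × P_{S₀}`, `H := 𝐇¹`, `H2 := Sel₀⋆`, `pair := supplyPair c̄₂` (`c̄₂` = the descent of `pair₂` along `colⁿ`, `exists_descend_of_ker_colN` + KER),
`locd := supplyLocd π πₐ`, `Z := (Λ_𝒪 z)|_𝒪`, `Sel₀ := π.Sel₀`, `f := π.f`, `B := π.B`. Derived inside: `hB` (= `π.hB`), `hpair` (S2's `ℤ₂`-compatibility +
`colN` linear + C5 integrand), `hlocd` (`cvec_padicInt_smul`, `AwayPins.hlocdS_smul`, `hC`), `hEH_Z` (C3 `reciprocity_of_pins`, for EVERY `x`), `horth`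
(C4 integrand through `colN_surjective` and T1 (f) `pair₂_eq_c₂_locKer`), `hDH` (C1 `hDHrel_of_pins` → C2 `deepHalf_of_pins`, the registered `ℤ₂`-slacks
converted by `AwayPins.exists_int_slack(_atTwo)`), `hPT` (`le_rfl`).

References: [Kobayashi2003] Thm. 7.3 ((7.17)–(7.21)); [MilneADT2006] Ch. I Thm. 4.10; [GreenbergVatsal2000] §2 Prop. 2.4; [Kato2004Asterisque]
§12.2, §13.8, §17.13.
-/

set_option autoImplicit false
-- the Theorems namespace of this sub repeats the summit name by design (D-0017 nested layout)
set_option linter.dupNamespace false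

noncomputable section

open scoped Classical TensorProduct

namespace Summit.BirchSwinnertonDyer.BirchSwinnertonDyer.Theorems.OnePair

open Literature.NumberTheory.EllipticCurves Literature.NumberTheory.EllipticCurves.GreenbergSelmer
open Literature.NumberTheory.GaloisRepresentations NumberField IsDedekindDomain Field WeierstrassCurve
open Literature.NumberTheory.EllipticCurves.CyclotomicLayer Literature.NumberTheory.EllipticCurves.Sprung2012
open Kobayashi2003 Rat.HeightOneSpectrum PowerSeries
open Summit.BirchSwinnertonDyer.BirchSwinnertonDyer.Theorems.ThetaTransport

variable {S : Set (PadicAlgCl 2)} {W : WeierstrassCurve ℚ} [W.IsElliptic] [W.IsGloballyMinimal] {κ : ZpExtension ℚ 2} {γ : absoluteGaloisGroup ℚ}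
  {S₀ : Finset (HeightOneSpectrum (𝓞 ℚ))} {n : ℕ} {ρ : FramedGaloisRep ℚ ↥(padicCoeffIntegers S) 2}
  {Θ : ∀ v : HeightOneSpectrum (𝓞 ℚ), ((2 : ℕ) : 𝓞 ℚ) ∈ v.asIdeal → (Cofree ρ ↥(padicCoeffField S) ≃+ (Fin n → ↥(W.geomPrimaryTorsion 2)))}
  {hΘ : ∀ v hv (δ : absoluteGaloisGroup (v.adicCompletion ℚ)) m i,
    Θ v hv (resGalOfEmb (closureEmb (K := ℚ) (v.adicCompletion ℚ)) δ • m) i = resGalOfEmb (closureEmb (K := ℚ) (v.adicCompletion ℚ)) δ • Θ v hv m i}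
  {I : Kato2004.IwasawaH1DataCoeff (FramedGaloisRep.toGaloisRep ρ) 2 κ γ}
  [Module ↥(padicCoeffIntegers S) I.H] [IsScalarTower ↥(padicCoeffIntegers S) (IwasawaAlgebraO S) I.H]
  {Sg : AddSubgroup (subgroupH1 κ.kerSubgroup (Cofree ρ ↥(padicCoeffField S)))} [Module ↥(padicCoeffIntegers S) ↥Sg]

-- many binders, a few big coercion towers in the hypotheses
set_option maxHeartbeats 1600000 in
/-- **The one-pair supply from the packages** (ASSEMBLY-SPEC-g19 clause C8): the N5 datum of the registered glue stub `stub_onePairSupply`, for the §0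
witnesses `P := ℤ₂⟦X⟧ⁿ × P_{S₀}`, `pair := supplyPair c̄₂`, `locd := supplyLocd π πₐ`, `Z := (Λ_𝒪 z)|_𝒪`, `Sel₀ := π.Sel₀`, `f := π.f`, `B := π.B`,
`H2 := Sel₀⋆`, from T1, T2, S2 at the pins, EH / S4₂ / S4₀, the C4/C5 integrands and the C6/C7 counts (`σ` = the S₀-count, `d`, `e` abstract).
[cite: Kobayashi2003, Thm. 7.3 ((7.17)–(7.21))] [cite: MilneADT2006, Ch. I, Thm. 4.10] [cite: GreenbergVatsal2000, §2 Prop. 2.4] -/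
theorem onePairSupply_of_packages (hGood : Rank1Residual.GoodSS W 2) (hκ : κ.IsCyclotomic)
    (hC : ∀ (a : ↥(padicCoeffIntegers S)) (x : I.H), a • x = (PowerSeries.C a : IwasawaAlgebraO S) • x)
    (π : OnePairPins S W κ γ S₀ n ρ Θ hΘ I Sg)
    -- T1: the AtTwo package
    [Module ℤ_[2] (Dloc S κ ρ π.v)] (π₂ : AtTwoPins S κ ρ S₀ W γ n Θ hΘ I Sg π)
    (hperf : Function.Surjective π₂.c₂) (Eplus : AddSubgroup (Dloc S κ ρ π.v))
    (hSg : ∀ s : subgroupH1 κ.kerSubgroup (Cofree ρ ↥(padicCoeffField S)), s ∈ Sg ↔ s ∈ selRelSubgroup S κ ρ S₀ ∧ locKer S κ ρ π.v s ∈ Eplus)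
    (hπker : ∀ t : (Fin n → ↥(localTowerPointsOfEmb κ (closureEmb (K := ℚ) (π.v.adicCompletion ℚ)) W)) →+ ℤ_[2],
      (∀ e ∈ Eplus, π₂.c₂ t e = 0) →
      ∀ i : Fin n, π.col (t.comp (AddMonoidHom.single (fun _ : Fin n => ↥(localTowerPointsOfEmb κ (closureEmb (K := ℚ) (π.v.adicCompletion ℚ)) W)) i)) = 0)
    -- T2: the Away package
    [∀ w : ↥S₀, Module ℤ_[2] (Dloc S κ ρ (w : HeightOneSpectrum (𝓞 ℚ)))] (πₐ : AwayPins S κ ρ S₀ W γ n Θ hΘ I Sg π)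
    -- S2 at the pins: the value character `pair₂`, its `ℤ₂`-compatibility, VALUE and KERNEL clauses
    (pair₂ : ((Fin n → ↥(localTowerPointsOfEmb κ (closureEmb (K := ℚ) (π.v.adicCompletion ℚ)) W)) →+ ℤ_[2]) →+ CharacterModule ↥Sg)
    (hpair₂ : ∀ (c : ℤ_[2]) (t : (Fin n → ↥(localTowerPointsOfEmb κ (closureEmb (K := ℚ) (π.v.adicCompletion ℚ)) W)) →+ ℤ_[2]) (s : ↥Sg),
      pair₂ (c • t) s = pair₂ t (padicIntToCoeffIntegers S c • s))
    (hP : ∀ (t : (Fin n → ↥(localTowerPointsOfEmb κ (closureEmb (K := ℚ) (π.v.adicCompletion ℚ)) W)) →+ ℤ_[2]) (s : ↥Sg)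
      (φ : contOneCocycles (discreteTopRep ↥κ.kerSubgroup (Cofree ρ ↥(padicCoeffField S))))
      (Q : Fin n → localPoints W (π.v.adicCompletion ℚ)) (k : ℕ)
      (hQ : ∀ i, (2 ^ k) • Q i ∈ localTowerPointsOfEmb κ (closureEmb (K := ℚ) (π.v.adicCompletion ℚ)) W),
      oneCocycleClass (discreteTopRep ↥κ.kerSubgroup (Cofree ρ ↥(padicCoeffField S))) φ =
          (s : subgroupH1 κ.kerSubgroup (Cofree ρ ↥(padicCoeffField S))) →
        (∀ (τ : ↥(localSubgroupOfEmb κ.kerSubgroup (closureEmb (K := ℚ) (π.v.adicCompletion ℚ)))) (i : Fin n),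
          pointsMapOfEmb W (closureEmb (K := ℚ) (π.v.adicCompletion ℚ))
            ((Θ π.v π.hv (φ.1 (resGalSubgroupOfEmb κ.kerSubgroup (closureEmb (K := ℚ) (π.v.adicCompletion ℚ)) τ)) i : ↥(W.geomPrimaryTorsion 2)) :
              W.geomPoints) = (τ : absoluteGaloisGroup (π.v.adicCompletion ℚ)) • Q i - Q i) →
        pair₂ t s = (PadicInt.toZModPow k (t (fun i => ⟨(2 ^ k) • Q i, hQ i⟩))).val • ((((2 : ℚ) ^ k)⁻¹ : ℚ) : AddCircle (1 : ℚ)))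
    (hKER : ∀ t : (Fin n → ↥(localTowerPointsOfEmb κ (closureEmb (K := ℚ) (π.v.adicCompletion ℚ)) W)) →+ ℤ_[2],
      (∀ i : Fin n, π.col (t.comp (AddMonoidHom.single
        (fun _ : Fin n => ↥(localTowerPointsOfEmb κ (closureEmb (K := ℚ) (π.v.adicCompletion ℚ)) W)) i)) = 0) → pair₂ t = 0)
    -- EH / S4₂ / S4₀ at (π, π₂, πₐ)
    (hEH : ∀ (x : I.H) (s : subgroupH1 κ.kerSubgroup (Cofree ρ ↥(padicCoeffField S))), s ∈ selRelSubgroup S κ ρ S₀ →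
      π₂.c₂ (π.locd₂ x) (locKer S κ ρ π.v s) +
        ∑ w : ↥S₀, ∑ᶠ c : Cosets κ (w : HeightOneSpectrum (𝓞 ℚ)), πₐ.locdS x w c (locAway S κ ρ S₀ s w c) = 0)
    (h42 : ∀ z : (Fin n → ↥(localTowerPointsOfEmb κ (closureEmb (K := ℚ) (π.v.adicCompletion ℚ)) W)) →+ ℤ_[2],
      (∀ s : subgroupH1 κ.kerSubgroup (Cofree ρ ↥(padicCoeffField S)), s ∈ selRelSubgroup S κ ρ S₀ → π₂.c₂ z (locKer S κ ρ π.v s) = 0) →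
      ∃ a : ℤ_[2], a ≠ 0 ∧ ∃ x : I.H, πₐ.locdS x = 0 ∧ a • z = π.locd₂ x)
    (h40 : ∀ χ : PAway S κ ρ S₀,
      (∀ s : subgroupH1 κ.kerSubgroup (Cofree ρ ↥(padicCoeffField S)), s ∈ selRelSubgroup S κ ρ S₀ → locKer S κ ρ π.v s = 0 →
        ∑ w : ↥S₀, ∑ᶠ c : Cosets κ (w : HeightOneSpectrum (𝓞 ℚ)), χ w c (locAway S κ ρ S₀ s w c) = 0) →
      ∃ a : ℤ_[2], a ≠ 0 ∧ ∃ x : I.H, a • χ = πₐ.locdS x)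
    -- C4: the `Sel₀`-orthogonality integrand; C5: the S₀-side compatibility integrand
    (horth₀ : ∀ s : ↥Sg, s ∈ π.Sel₀ →
      ∀ (t : (Fin n → ↥(localTowerPointsOfEmb κ (closureEmb (K := ℚ) (π.v.adicCompletion ℚ)) W)) →+ ℤ_[2]) (χ : PAway S κ ρ S₀),
        π₂.c₂ t (locKer S κ ρ π.v (s : subgroupH1 κ.kerSubgroup (Cofree ρ ↥(padicCoeffField S)))) +
          ∑ w : ↥S₀, ∑ᶠ c : Cosets κ (w : HeightOneSpectrum (𝓞 ℚ)),
            χ w c (locAway S κ ρ S₀ (s : subgroupH1 κ.kerSubgroup (Cofree ρ ↥(padicCoeffField S))) w c) = 0)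
    (hsumS : ∀ (a : ℤ_[2]) (χ : PAway S κ ρ S₀) (s : ↥Sg),
      ∑ w : ↥S₀, ∑ᶠ c : Cosets κ (w : HeightOneSpectrum (𝓞 ℚ)),
          (a • χ) w c (locAway S κ ρ S₀ (s : subgroupH1 κ.kerSubgroup (Cofree ρ ↥(padicCoeffField S))) w c) =
        ∑ w : ↥S₀, ∑ᶠ c : Cosets κ (w : HeightOneSpectrum (𝓞 ℚ)),
          χ w c (locAway S κ ρ S₀ ((padicIntToCoeffIntegers S a • s : ↥Sg) : subgroupH1 κ.kerSubgroup (Cofree ρ ↥(padicCoeffField S))) w c))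
    -- C7 / C6: the counts, in the supply's currency
    (z : I.H) (d e σ : ℕ)
    (hfinH : Module.Finite (FractionRing ↥(padicCoeffIntegers S)) (TensorProduct ↥(padicCoeffIntegers S) (FractionRing ↥(padicCoeffIntegers S))
      (I.H ⧸ (Submodule.span (IwasawaAlgebraO S) ({z} : Set I.H)).restrictScalars ↥(padicCoeffIntegers S))))
    (hfinP : Module.Finite ℚ_[2] (TensorProduct ℤ_[2] ℚ_[2] (((Fin n → PowerSeries ℤ_[2]) × PAway S κ ρ S₀) ⧸
      Submodule.span ℤ_[2] (supplyLocd π πₐ ''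
        (((Submodule.span (IwasawaAlgebraO S) ({z} : Set I.H)).restrictScalars ↥(padicCoeffIntegers S) :
          Submodule ↥(padicCoeffIntegers S) I.H) : Set I.H)))))
    (hcount : π.f * (d + σ + e) ≤ Module.finrank ℚ_[2] (TensorProduct ℤ_[2] ℚ_[2] (((Fin n → PowerSeries ℤ_[2]) × PAway S κ ρ S₀) ⧸
      Submodule.span ℤ_[2] (supplyLocd π πₐ ''
        (((Submodule.span (IwasawaAlgebraO S) ({z} : Set I.H)).restrictScalars ↥(padicCoeffIntegers S) :
          Submodule ↥(padicCoeffIntegers S) I.H) : Set I.H)))))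
    (hii : Module.finrank (FractionRing ↥(padicCoeffIntegers S)) (TensorProduct ↥(padicCoeffIntegers S) (FractionRing ↥(padicCoeffIntegers S))
        (I.H ⧸ (Submodule.span (IwasawaAlgebraO S) ({z} : Set I.H)).restrictScalars ↥(padicCoeffIntegers S))) ≤
      Module.finrank (FractionRing ↥(padicCoeffIntegers S)) (TensorProduct ↥(padicCoeffIntegers S) (FractionRing ↥(padicCoeffIntegers S))
        (CharacterModule ↥π.Sel₀)) + e) :
    ∃ (P : Type) (_ : AddCommGroup P) (_ : Module ℤ_[2] P) (H : Type) (_ : AddCommGroup H) (_ : Module ↥(padicCoeffIntegers S) H)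
      (H2 : Type) (_ : AddCommGroup H2) (_ : Module ↥(padicCoeffIntegers S) H2) (pair : P →+ CharacterModule ↥Sg) (locd : H →+ P)
      (Z : Submodule ↥(padicCoeffIntegers S) H) (Sel₀ : Submodule ↥(padicCoeffIntegers S) ↥Sg) (e f : ℕ)
      (B : (Fin f → ℤ_[2]) ≃+ ↥(padicCoeffIntegers S)),
      (∀ (z : ℤ_[2]) (c : Fin f → ℤ_[2]), B (z • c) = padicIntToCoeffIntegers S z * B c) ∧
      (∀ (z : ℤ_[2]) (t : P) (s : ↥Sg), pair (z • t) s = pair t (padicIntToCoeffIntegers S z • s)) ∧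
      (∀ (z : ℤ_[2]) (x : H), locd (padicIntToCoeffIntegers S z • x) = z • locd x) ∧
      (∀ x ∈ Z, pair (locd x) = 0) ∧ (∀ s ∈ Sel₀, ∀ t : P, pair t s = 0) ∧
      (∀ t : P, pair t = 0 → ∃ a : ℤ_[2], a ≠ 0 ∧ ∃ x : H, a • t = locd x) ∧
      Module.Finite (FractionRing ↥(padicCoeffIntegers S))
        (TensorProduct ↥(padicCoeffIntegers S) (FractionRing ↥(padicCoeffIntegers S)) (H ⧸ Z)) ∧
      Module.Finite ℚ_[2] (TensorProduct ℤ_[2] ℚ_[2] (P ⧸ Submodule.span ℤ_[2] (locd '' (Z : Set H)))) ∧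
      f * (d + σ + e) ≤ Module.finrank ℚ_[2] (TensorProduct ℤ_[2] ℚ_[2] (P ⧸ Submodule.span ℤ_[2] (locd '' (Z : Set H)))) ∧
      Module.finrank (FractionRing ↥(padicCoeffIntegers S))
          (TensorProduct ↥(padicCoeffIntegers S) (FractionRing ↥(padicCoeffIntegers S)) (H ⧸ Z)) ≤
        Module.finrank (FractionRing ↥(padicCoeffIntegers S))
          (TensorProduct ↥(padicCoeffIntegers S) (FractionRing ↥(padicCoeffIntegers S)) H2) + e ∧
      Module.finrank (FractionRing ↥(padicCoeffIntegers S))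
          (TensorProduct ↥(padicCoeffIntegers S) (FractionRing ↥(padicCoeffIntegers S)) H2) ≤
        Module.finrank (FractionRing ↥(padicCoeffIntegers S))
          (TensorProduct ↥(padicCoeffIntegers S) (FractionRing ↥(padicCoeffIntegers S)) (CharacterModule ↥Sel₀)) := by
  -- §1 the 2-side pairing `c̄₂` on `ℤ₂⟦X⟧ⁿ`: the descent of `pair₂` along `colⁿ` (KER clause of S2)
  obtain ⟨c2bar, hc2bar_def, -⟩ := π.exists_descend_of_ker_colN pair₂ fun t ht ↦ hKER t fun i ↦ by
    rw [← π.colN_apply, ht, Pi.zero_apply]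
  -- T1 (f): `c̄₂ (colⁿ t₀) s = pair₂ t₀ s = c₂ t₀ (loc₂ s)`
  have hc2bar : ∀ (t₀ : (Fin n → ↥(localTowerPointsOfEmb κ (closureEmb (K := ℚ) (π.v.adicCompletion ℚ)) W)) →+ ℤ_[2]) (s : ↥Sg),
      c2bar (π.colN t₀) s = π₂.c₂ t₀ (locKer S κ ρ π.v (s : subgroupH1 κ.kerSubgroup (Cofree ρ ↥(padicCoeffField S)))) := fun t₀ s ↦ by
    rw [hc2bar_def]
    exact AtTwoPackage.pair₂_eq_c₂_locKer S ρ W κ Θ hΘ π.v π.hv hGood hκ Sg pair₂ hP π₂.c₂ π₂.hc₂ t₀ s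
  have hc2barA : ∀ (t₀ : (Fin n → ↥(localTowerPointsOfEmb κ (closureEmb (K := ℚ) (π.v.adicCompletion ℚ)) W)) →+ ℤ_[2]) (s : ↥Sg),
      c2bar (π.colN.toAddMonoidHom t₀) s = π₂.c₂ t₀ (locKer S κ ρ π.v (s : subgroupH1 κ.kerSubgroup (Cofree ρ ↥(padicCoeffField S)))) :=
    hc2bar
  -- `colⁿ` as the coarsening of C2/C3
  have hcN : Function.Surjective π.colN.toAddMonoidHom := π.colN_surjective
  have hπker' : ∀ h : (Fin n → ↥(localTowerPointsOfEmb κ (closureEmb (K := ℚ) (π.v.adicCompletion ℚ)) W)) →+ ℤ_[2],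
      (∀ e ∈ Eplus, π₂.c₂ h e = 0) → π.colN.toAddMonoidHom h = 0 := fun h hh ↦ funext fun i ↦ by
    rw [LinearMap.toAddMonoidHom_coe, π.colN_apply, Pi.zero_apply]
    exact hπker h hh i
  have hcvec : ∀ x : I.H, π.colN.toAddMonoidHom (π.locd₂ x) = π.cvec x := fun x ↦ (π.cvec_eq_colN_locd₂ x).symm
  -- §2 the registered `ℤ₂`-slacks of S4₂ / S4₀, in the integer-cast currency of C1
  have h42' : ∀ z : (Fin n → ↥(localTowerPointsOfEmb κ (closureEmb (K := ℚ) (π.v.adicCompletion ℚ)) W)) →+ ℤ_[2],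
      (∀ s : subgroupH1 κ.kerSubgroup (Cofree ρ ↥(padicCoeffField S)), s ∈ selRelSubgroup S κ ρ S₀ → π₂.c₂ z (locKer S κ ρ π.v s) = 0) →
      ∃ m : ℤ, m ≠ 0 ∧ ∃ x : I.H, πₐ.locdS x = 0 ∧ (m : ℤ_[2]) • z = π.locd₂ x := fun z hz ↦ by
    obtain ⟨m, hm, x, hx0, hx⟩ := AwayPins.exists_int_slack_atTwo π πₐ (h42 z hz)
    exact ⟨m, hm, x, hx0, by rw [Int.cast_smul_eq_zsmul, hx]⟩
  have h40' : ∀ χ : PAway S κ ρ S₀,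
      (∀ s : subgroupH1 κ.kerSubgroup (Cofree ρ ↥(padicCoeffField S)), s ∈ selRelSubgroup S κ ρ S₀ → locKer S κ ρ π.v s = 0 →
        ∑ w : ↥S₀, ∑ᶠ c : Cosets κ (w : HeightOneSpectrum (𝓞 ℚ)), χ w c (locAway S κ ρ S₀ s w c) = 0) →
      ∃ m : ℤ, m ≠ 0 ∧ ∃ x : I.H, (m : ℤ_[2]) • χ = πₐ.locdS x := fun χ hχ ↦ by
    obtain ⟨m, hm, x, hx⟩ := AwayPins.exists_int_slack π πₐ (h40 χ hχ)
    exact ⟨m, hm, x, by rw [Int.cast_smul_eq_zsmul, hx]⟩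
  -- §3 the datum
  refine ⟨(Fin n → PowerSeries ℤ_[2]) × PAway S κ ρ S₀, inferInstance, inferInstance, I.H, inferInstance, inferInstance,
    CharacterModule ↥π.Sel₀, inferInstance, inferInstance, supplyPair S κ ρ S₀ Sg c2bar, supplyLocd π πₐ,
    (Submodule.span (IwasawaAlgebraO S) ({z} : Set I.H)).restrictScalars ↥(padicCoeffIntegers S), π.Sel₀, e, π.f, π.B, π.hB,
    ?_, ?_, ?_, ?_, ?_, hfinH, hfinP, hcount, hii, le_rfl⟩
  · -- hpair: `pair (a • t) s = pair t (ι a • s)` — S2's compatibility through `colN`, and the S₀-side integrand (C5)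
    intro a t s
    obtain ⟨t₀, ht₀⟩ := π.colN_surjective t.1
    rw [supplyPair_apply, supplyPair_apply, Prod.smul_fst, Prod.smul_snd, ← ht₀, ← map_smul π.colN a t₀, hc2bar_def, hc2bar_def,
      hpair₂ a t₀ s, hsumS a t.2 s]
  · -- hlocd: `locd (ι a • x) = a • locd x`
    intro a x
    rw [hC, supplyLocd_apply, supplyLocd_apply, π.cvec_padicInt_smul, πₐ.hlocdS_smul, Prod.smul_mk]
  · -- hEH_Z: reciprocity (C3), for every `x`
    intro x _
    refine DFunLike.ext _ _ fun s ↦ ?_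
    rw [supplyLocd_apply, supplyPair_apply]
    -- `(0 : Sg⋆) s = 0` definitionally
    exact reciprocity_of_pins π π₂ πₐ Eplus hSg π.colN.toAddMonoidHom hcvec c2bar hc2barA hEH x s
  · -- horth: `Sel₀`-orthogonality (C4) through `colN`
    intro s hs t
    obtain ⟨t₀, ht₀⟩ := π.colN_surjective t.1
    rw [supplyPair_apply, ← ht₀, hc2bar]
    exact horth₀ s hs t₀ t.2
  · -- hDH: place cut (C1) → deep half (C2); integer slack ⟹ `ℤ₂`-slack
    intro t ht
    have ht' : ∀ s : ↥Sg, c2bar t.1 s + ∑ w : ↥S₀, ∑ᶠ c : Cosets κ (w : HeightOneSpectrum (𝓞 ℚ)),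
        t.2 w c (locAway S κ ρ S₀ (s : subgroupH1 κ.kerSubgroup (Cofree ρ ↥(padicCoeffField S))) w c) = 0 := fun s ↦
      -- `(0 : Sg⋆) s = 0` definitionally
      (supplyPair_apply S κ ρ S₀ Sg c2bar t s).symm.trans (DFunLike.congr_fun ht s)
    obtain ⟨m, hm, x, hx⟩ := deepHalf_of_pins π π₂ πₐ Eplus hperf hSg π.colN.toAddMonoidHom hcN hπker' hcvec c2bar hc2barA
      (hDHrel_of_pins π π₂ πₐ hEH h42' h40') t ht'
    exact ⟨(m : ℤ_[2]), Int.cast_ne_zero.mpr hm, x, by rw [hx, supplyLocd_apply]⟩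

end Summit.BirchSwinnertonDyer.BirchSwinnertonDyer.Theorems.OnePair

end
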